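import Literature.Probability.Percolation.QuadCrossingRawClosed
import HarnessLib

/-!
# Reparametrised quads

Topic `Literature/Probability/Percolation`.  Schramm–Smirnov keep quads parametrised ("We introduce
some redundancy …", *On the scaling limits of planar percolation* (2011), §1.3), but the crossing
structure of a quad `Q : [0,1]² → ℂ` depends only on its image `[Q]` and its sides: composing `Q`
with a homeomorphism `k` of the square that maps each side of the square onto itself gives a quad
`Q.reparam k` with the same carrier, the same four sides, the same crossings, hence comparable in
both directions with `Q` (`Dominated`) and crossed by exactly the same discrete configurations
(`mem_z2QuadConfig_reparam_iff`).  Moreover `P ↦ P.reparam k` is an isometry of `𝒬_D` carrying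
the relation `≤` onto itself, hence also `<` (`strictlyDominated_reparam_iff`).  (No claim is made
that `⊞_{Q.reparam k} = ⊞_Q` inside `ℋ_D`.)  This is the device by which a quad with a wild
boundary parametrisation is approximated, in the metric of `𝒬_D`, by quads whose boundary CURVES
are nice (general position for Theorem 1.7).

## References

* O. Schramm, S. Smirnov, Ann. Probab. 39 (2011), §1.3. [SchrammSmirnov2011]
-/

noncomputable section

open Set Metric
open scoped unitInterval

namespace Literature.Probability.Percolation

namespace QuadCrossing

namespace Quad

variable {D : Set ℂ}

/-- A homeomorphism of the square **preserves the sides** if it maps each of the four sides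
`{x = 0}`, `{y = 0}`, `{x = 1}`, `{y = 1}` onto itself. [folklore] -/
structure SidePreserving (k : I × I ≃ₜ I × I) : Prop where
  fst_eq_zero : ∀ p, (k p).1 = 0 ↔ p.1 = 0
  snd_eq_zero : ∀ p, (k p).2 = 0 ↔ p.2 = 0
  fst_eq_one : ∀ p, (k p).1 = 1 ↔ p.1 = 1
  snd_eq_one : ∀ p, (k p).2 = 1 ↔ p.2 = 1

/-- The identity preserves the sides. [folklore] -/
theorem SidePreserving.refl : SidePreserving (Homeomorph.refl (I × I)) :=
  ⟨fun _ => Iff.rfl, fun _ => Iff.rfl, fun _ => Iff.rfl, fun _ => Iff.rfl⟩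

/-- Inverses of side-preserving homeomorphisms preserve the sides. [folklore] -/
theorem SidePreserving.symm {k : I × I ≃ₜ I × I} (hk : SidePreserving k) : SidePreserving k.symm := by
  refine ⟨fun p => ?_, fun p => ?_, fun p => ?_, fun p => ?_⟩
  · simpa using (hk.fst_eq_zero (k.symm p)).symm
  · simpa using (hk.snd_eq_zero (k.symm p)).symm
  · simpa using (hk.fst_eq_one (k.symm p)).symm
  · simpa using (hk.snd_eq_one (k.symm p)).symm

/-- Composites of side-preserving homeomorphisms preserve the sides. [folklore] -/
theorem SidePreserving.trans {k k' : I × I ≃ₜ I × I} (hk : SidePreserving k) (hk' : SidePreserving k') :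
    SidePreserving (k.trans k') := by
  refine ⟨fun p => ?_, fun p => ?_, fun p => ?_, fun p => ?_⟩
  · simp [hk'.fst_eq_zero, hk.fst_eq_zero]
  · simp [hk'.snd_eq_zero, hk.snd_eq_zero]
  · simp [hk'.fst_eq_one, hk.fst_eq_one]
  · simp [hk'.snd_eq_one, hk.snd_eq_one]

/-- **The reparametrised quad `Q ∘ k`.** [cite: SchrammSmirnov2011, §1.3] -/
def reparam (Q : Quad D) (k : I × I ≃ₜ I × I) : Quad D where
  toFun := Q ∘ k
  continuous_toFun := Q.continuous_toFun.comp k.continuous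
  injective_toFun := Q.injective_toFun.comp k.injective
  range_subset := (range_comp_subset_range _ _).trans Q.range_subset

/-- `reparam_apply`: structural lemma. [folklore] -/
@[simp] theorem reparam_apply (Q : Quad D) (k : I × I ≃ₜ I × I) (p : I × I) :
    Q.reparam k p = Q (k p) := rfl

/-- Reparametrising twice. [folklore] -/
theorem reparam_reparam (Q : Quad D) (k k' : I × I ≃ₜ I × I) :
    (Q.reparam k).reparam k' = Q.reparam (k'.trans k) := rfl

/-- Reparametrising by `k` and then `k⁻¹`. [folklore] -/
@[simp] theorem reparam_reparam_symm (Q : Quad D) (k : I × I ≃ₜ I × I) :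
    (Q.reparam k).reparam k.symm = Q := by
  ext p; simp

/-- Reparametrising by `k⁻¹` and then `k`. [folklore] -/
@[simp] theorem reparam_symm_reparam (Q : Quad D) (k : I × I ≃ₜ I × I) :
    (Q.reparam k.symm).reparam k = Q := by
  ext p; simp

/-- **Same carrier.** [folklore] -/
@[simp] theorem carrier_reparam (Q : Quad D) (k : I × I ≃ₜ I × I) : (Q.reparam k).carrier = Q.carrier := by
  show range (Q ∘ k) = range Q
  exact k.surjective.range_comp _

/-- **Same sides** (for side-preserving `k`). [folklore] -/
theorem side_reparam (Q : Quad D) {k : I × I ≃ₜ I × I} (hk : SidePreserving k) (i : Fin 4) :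
    (Q.reparam k).side i = Q.side i := by
  have key : ∀ (P : I × I → Prop) (_ : ∀ p, P (k p) ↔ P p),
      (Q ∘ k) '' {z | P z} = Q '' {z | P z} := by
    intro P hP
    ext w
    constructor
    · rintro ⟨p, hp, rfl⟩; exact ⟨k p, (hP p).2 hp, rfl⟩
    · rintro ⟨q, hq, rfl⟩
      exact ⟨k.symm q, (hP (k.symm q)).1 (by simpa using hq), by simp⟩
  match i with
  | 0 => exact key (fun z => z.1 = 0) hk.fst_eq_zero
  | 1 => exact key (fun z => z.2 = 0) hk.snd_eq_zero
  | 2 => exact key (fun z => z.1 = 1) hk.fst_eq_one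
  | 3 => exact key (fun z => z.2 = 1) hk.snd_eq_one

/-- **Same crossings.** [cite: SchrammSmirnov2011, §1.3] -/
theorem isCrossing_reparam_iff (Q : Quad D) {k : I × I ≃ₜ I × I} (hk : SidePreserving k) (K : Set ℂ) :
    (Q.reparam k).IsCrossing K ↔ Q.IsCrossing K := by
  simp only [IsCrossing, carrier_reparam, side_reparam Q hk]

/-- Hence `Q ∘ k ≤ Q` and `Q ≤ Q ∘ k`. [cite: SchrammSmirnov2011, §1.3] -/
theorem dominated_reparam_self (Q : Quad D) {k : I × I ≃ₜ I × I} (hk : SidePreserving k) :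
    Dominated (Q.reparam k) Q := fun K hK =>
  ⟨K, Subset.rfl, (isCrossing_reparam_iff Q hk K).2 hK⟩

/-- Hence `Q ≤ Q ∘ k`. [cite: SchrammSmirnov2011, §1.3] -/
theorem dominated_self_reparam (Q : Quad D) {k : I × I ≃ₜ I × I} (hk : SidePreserving k) :
    Dominated Q (Q.reparam k) := fun K hK =>
  ⟨K, Subset.rfl, (isCrossing_reparam_iff Q hk K).1 hK⟩

/-- `≤` is unchanged by side-preserving reparametrisation of both quads. [folklore] -/
theorem dominated_reparam_iff {Q₁ Q₂ : Quad D} {k : I × I ≃ₜ I × I} (hk : SidePreserving k) :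
    Dominated (Q₁.reparam k) (Q₂.reparam k) ↔ Dominated Q₁ Q₂ := by
  simp only [Dominated, isCrossing_reparam_iff _ hk]

/-- **The same discrete configurations cross `Q ∘ k` and `Q`** (`δ > 0`): `Q ∘ k ∈ ω_δ ↔ Q ∈ ω_δ`.
[cite: SchrammSmirnov2011, §1.3] -/
theorem mem_z2QuadConfig_reparam_iff (Q : Quad D) {k : I × I ≃ₜ I × I} (hk : SidePreserving k)
    {δ : ℝ} (hδ : 0 < δ) (ω : BondConfig (Literature.Probability.LatticeModels.Site 2)) :
    Q.reparam k ∈ z2QuadConfig D δ ω ↔ Q ∈ z2QuadConfig D δ ω := by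
  simp only [mem_z2QuadConfig_iff_exists_isCrossing hδ, isCrossing_reparam_iff Q hk]

/-- Hence the discrete crossing events agree: `{ω | Q ∘ k ∈ ω_δ} = {ω | Q ∈ ω_δ}`. [folklore] -/
theorem preimage_crossedEvent_reparam (Q : Quad D) {k : I × I ≃ₜ I × I} (hk : SidePreserving k)
    {δ : ℝ} (hδ : 0 < δ) :
    z2QuadConfig D δ ⁻¹' QuadConfig.crossedEvent (Q.reparam k) =
      z2QuadConfig D δ ⁻¹' QuadConfig.crossedEvent Q := by
  ext ω
  simp only [mem_preimage, QuadConfig.mem_crossedEvent, mem_z2QuadConfig_reparam_iff Q hk hδ]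

/-! ### Reparametrisation as an isometry of `𝒬_D` -/

/-- **`P ↦ P ∘ k` is an isometry of `𝒬_D`.** [folklore] -/
theorem dist_reparam_reparam (Q Q' : Quad D) (k : I × I ≃ₜ I × I) :
    dist (Q.reparam k) (Q'.reparam k) = dist Q Q' := by
  refine le_antisymm ?_ ?_
  · rw [dist_eq, ContinuousMap.dist_le dist_nonneg]
    intro p
    exact dist_apply_le Q Q' (k p)
  · rw [dist_eq Q, ContinuousMap.dist_le dist_nonneg]
    intro p
    have := dist_apply_le (Q.reparam k) (Q'.reparam k) (k.symm p)
    simpa using this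

/-- The distance from `Q ∘ k` to `Q` is the sup of `|Q (k p) - Q p|`; in particular it is at most `ε`
as soon as all these are. [folklore] -/
theorem dist_reparam_le {Q : Quad D} {k : I × I ≃ₜ I × I} {ε : ℝ} (hε : 0 ≤ ε)
    (h : ∀ p, dist (Q (k p)) (Q p) ≤ ε) : dist (Q.reparam k) Q ≤ ε := by
  rw [dist_eq, ContinuousMap.dist_le hε]
  exact h

/-- Reparametrisation by `k` as a self-homeomorphism of `𝒬_D`. [folklore] -/
def reparamHomeomorph (k : I × I ≃ₜ I × I) : Quad D ≃ₜ Quad D where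
  toFun Q := Q.reparam k
  invFun Q := Q.reparam k.symm
  left_inv Q := reparam_reparam_symm Q k
  right_inv Q := reparam_symm_reparam Q k
  continuous_toFun := (Isometry.of_dist_eq fun Q Q' => dist_reparam_reparam Q Q' k).continuous
  continuous_invFun := (Isometry.of_dist_eq fun Q Q' => dist_reparam_reparam Q Q' k.symm).continuous

/-- `reparamHomeomorph_apply`: structural lemma. [folklore] -/
@[simp] theorem reparamHomeomorph_apply (k : I × I ≃ₜ I × I) (Q : Quad D) :
    reparamHomeomorph k Q = Q.reparam k := rfl

/-- **`<` is unchanged by side-preserving reparametrisation of both quads** (the isometry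
`P ↦ P ∘ k` maps `{(P, P') | P ≤ P'}` onto itself, hence also its interior). [cite: SchrammSmirnov2011, §1.3] -/
theorem strictlyDominated_reparam_iff {Q₁ Q₂ : Quad D} {k : I × I ≃ₜ I × I} (hk : SidePreserving k) :
    StrictlyDominated (Q₁.reparam k) (Q₂.reparam k) ↔ StrictlyDominated Q₁ Q₂ := by
  set Φ : Quad D × Quad D ≃ₜ Quad D × Quad D :=
    (reparamHomeomorph k).prodCongr (reparamHomeomorph k) with hΦ
  have hset : Φ ⁻¹' {p : Quad D × Quad D | Dominated p.1 p.2} = {p | Dominated p.1 p.2} := by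
    ext p
    simp only [mem_preimage, mem_setOf_eq]
    show Dominated (p.1.reparam k) (p.2.reparam k) ↔ _
    exact dominated_reparam_iff hk
  show Φ (Q₁, Q₂) ∈ interior {p : Quad D × Quad D | Dominated p.1 p.2} ↔
    (Q₁, Q₂) ∈ interior {p : Quad D × Quad D | Dominated p.1 p.2}
  rw [← mem_preimage, Φ.preimage_interior, hset]

/-- A one-sided version: `Q₁ ∘ k < Q₂ ↔ Q₁ < Q₂ ∘ k⁻¹`. [folklore] -/
theorem strictlyDominated_reparam_left_iff {Q₁ Q₂ : Quad D} {k : I × I ≃ₜ I × I} (hk : SidePreserving k) :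
    StrictlyDominated (Q₁.reparam k) Q₂ ↔ StrictlyDominated Q₁ (Q₂.reparam k.symm) := by
  conv_lhs => rw [← reparam_symm_reparam Q₂ k]
  exact strictlyDominated_reparam_iff hk

end Quad

end QuadCrossing

end Literature.Probability.Percolation

end
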